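import Literature.MathematicalPhysics.QuantumFieldTheory.Balaban1983to89.B11
import Literature.MathematicalPhysics.QuantumFieldTheory.Balaban1983to89.B11Smallness

/-!
# `Balaban1983to89.B11Carve13SectDHyp` — [Balaban1985Variational] pp. 289–294 (end of Sect. C: (70)–(73); Sect. D «Equations
# for a Solution of the Variational Problem»: (74)–(114), Propositions 4 and 5) CARVED IN HYPOTHESIS FORM — the residual
# printed statements of these six pages that had no declaration, typed over the Landau-gauge carrier `B11.LGData` extended by
# the letters Sect. D speaks about, and ONE bundle `B11Carve13SectDHyp.Hyp` conjoining the section's printed statements BY NAME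
# (P6 carving fan, block 13; key item stmt-QuantumFields-20541, also feeds 19200, 20520)

statement-level skeleton of published theorems with citation tags; proofs where landed; nothing here is a claim about the Yang–Mills mass gap

CITATION HEADER.  T. Bałaban, *The variational problem and background fields in renormalization group method for lattice gauge
theories*, Commun. Math. Phys. **102** (1985) 277–309, doi:10.1007/bf01229381 [Balaban1985Variational] (cell paper B11; its references
[3] = [Balaban1984PropagatorsII] (B6), [4] = [Balaban1985Averaging] (B7), [5] = [Balaban1985BackgroundPropagators] (B9), [6] =
[Balaban1985RegularSpaces] (B8)).  PDF held: `paper:balaban1985-cmp102-variational-background` (journal page = PDF page + 276);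
pp. 289–294 = PDF 13–18 re-read first-hand on the renders `pub-balaban/b2b-balaban-ref1/pages/1985-cmp102-variational-background/
…-p013…p018-x2.png` (and p. 281 = p005, p. 285 = p009 for the sentences of Sects. A, C that Sect. D invokes); the locators «p. N L a–b»
below are line numbers of the text layer `pNNNN.txt` of `lit read` (displays counted as lines).  The paper is a MANUSCRIPT UNDER
ADJUDICATION in this tree: every `def … : Prop` below is a PRINTED statement typed as a proposition to be used as a HYPOTHESIS
`(h : …)`; every `theorem` is kernel-checked bookkeeping between typed forms, elementary normed-group / linear algebra, or real
arithmetic of printed constants.  WHAT IS REPRODUCED = SKELETON rows B11.Eq70, Eq72, Eq73, Eq74, Eq78, Eq82, Eq85, Prop4, Eq99,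
Eq105, Prop5, Eq113 (all IN TREE — cited, not restated) plus the residual sentences listed under WHAT THIS FILE ADDS.  Unit
`lit-balaban-carve-13` (HOME `run/shared/lean/pub/lit-balaban/carve/`, rules `carve/CARVE-RULES.md`, block table
`carve/BLOCKS-11-20.md` § Block 13); imports `…B11` (hence Mathlib, `…B8`) and `…B11Smallness` only; nothing in the tree is edited.

## IN TREE = CITED (the printed items of pp. 289–294 that already have declarations; NOT restated here)

* p. 289 (70) «Equation (68) is uniquely solvable by a convergent Neumann series, 𝔇(A′) = (I + ℜ)⁻¹L^{j(·)}η((δ/δA)C)(A′ − HD(A′))»: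
  row B11.Eq70 — `B11Eq63FunctionalDerivative.*` (implicit-function / Neumann form of 𝔇), `B11Eq70Concrete.eq68_concrete`,
  `eq70_concrete`, `eq70_neumann_concrete`, `isInvertible_one_add_R` (concrete remainder `C_j` of [4] on `ℤᵈ`); the majorant
  vocabulary in which (73) is read downstream: `B11SectG.HasMaj` (row cite).
* p. 289 (71) and L5–8 «A kernel of the operator (I + ℜ)⁻¹ satisfies the bound (71) for ε₃ sufficiently small, which follows from
  Lemma 2.1 [3]»: `B11Eq71KernelConcrete.ineq69_kernel`, `ineq71_kernel`, `ineq71_inverse`, `ineq71_two` (kernel level, decay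
  e^{−½δ₀d(c₋,c′₋)}, Lemma 2.1 [3] = `B6Lemma21TwoScale.singleScale_row_sum` by name, statement `B6.Lemma21Printed`); the printed
  smallness «(1 − 9C₂B₀ε₃dc₁(½))⁻¹ ≦ 2» as `B11Eq73KernelDecay.ineq71_second` (18C₂B₀dc₁(½)ε₃ ≤ 1, the «e.g.» of Prop. 3).
* p. 289 (72) «Proposition 5 of [4] implies that (72)»: row B11.Eq72 — `B7.Prop5Printed` ([4] Prop. 5 (156)–(157)),
  `B11Eq72Concrete.ineq72_concrete_single`, `opNorm_fderiv_Cmap_le_72`, `ineq72_at_fixedPoint` (+ the locality clause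
  `fderiv_Cmap_single_eq_zero`); L12–14 «the factor (Lʲη)^{−d} comes from the change of scale» is the scaling inside these.
* p. 289 (73) «The formula (70) and the inequalities (71), (72) give finally (73)»: row B11.Eq73 — `B11.Prop3Printed` (last clause,
  O(1) explicit), `B11Eq73KernelDecay.ineq73`, `ineq73_printed` (abstract multiscale geometry), `B11Eq73KernelConcrete.ineq73_concrete`,
  `ineq73_Dfix` (concrete), `B11Prop3Model.prop3Printed_model` / `B11Prop3Concrete.prop3Printed_concrete` (Prop. 3 inhabited; (73)
  at norm level `norm_fderiv_Dt_le_73`), kernel columns `B11Eq73KernelColumnsCarrier.colSum_kernel_fderiv_Emap_le`.  Proposition 3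
  itself (L17–23) and the remark on 𝔇₂ (L24–28) are block 12's rows (`B11.Prop3Printed`, `B11SchwarzRemainder.reading_frakD2`).
* pp. 289–290 (74)–(77) «we consider the functional (74) on the space of field configurations A′ satisfying (75)–(77)»: row B11.Eq74 —
  `B11Eq81Expansion.functional74` ((74) with body); the chart K = {(75), (76), (77)}: `B11GlobalMin.ChartCovers` (row cite; coverage
  of (6) by the chart), `chart_convex_of_pieces`, `normBall_preimage_convex`; concretely `B11Prop7Model.ChartDatum.Kset` /
  `mem_Kset_iff` ((75)–(76) as `QA′ = b, RD*A′ = 0`), `B11Prop5Model.VarDatum` (the block datum b of (20)/(75)); (77) = the carrier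
  size `B11.LGData.nMax` («max{|A′|₍₋₁₎, |∇A′|₍₋₂₎}», (98)/(104)/(115)) and the norm of `B11Eq115Space.Space115`; the bound
  «|B| < 2dLC₁ε₁» of (75) is (20) p. 281 (`B11.LGData.In19_21` docstring) and enters `B11Smallness.ineq103`.
* p. 290 L8–18 (78), (79) (orders of 𝔉; D⁽²⁾ = C⁽²⁾; «½⟨A′, Δ_πA′⟩ − ⟨HC⁽²⁾(A′), J⟩ = … = ½⟨A′, Δ₁A′⟩, (79) where we have used again
  … RD*A′ = 0»): row B11.Eq78 — `B11Eq81Expansion.eq78`, `eq79`, `V80` ((80) with body), `eq81` ((81) as an identity of functionals,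
  `B11Eq127EulerLagrange.functional81`); the cross term's current `B11Eq79LinearTerm.*`, `B11Eq79LinearTermUniform.*`; on the lattice
  carriers `B11Eq80Current.V80` ((80)), `W1`/`W2`/`W3`/`W80` ((85), (88), (89), W = (δ/δA′)V) with the (63) certificate `pair27_W80`.
* p. 290 (81)–(84) «To find critical points … (82) holds for all δA′ in the tangent space, that is δA′ satisfying (83) … From (81) we
  have (84). The functional derivatives above are calculated without any restrictions on variations»: row B11.Eq82 —
  `B11Eq81Expansion.IsCritical82`, `tangent83`, `mem_tangent83_iff`, `hasFDerivAt84` (the UNRESTRICTED Fréchet derivative of (81)),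
  `hasFDerivAt84_apply`, `isCritical82_iff`; (82) ⇔ (99): `B11Prop5Model.critical82_iff_eq99`.
* p. 291 (85)–(86) «and from the bound (73) it follows that (86) ≦ O(1)ε₁ε₃²(Lʲη)⁻³ … We have gathered together all the constants into
  an absolute constant O(1)»: row B11.Eq85 — `B11Eq85FirstDerivative.hasFDerivAt85`, `hasFDerivAt85_apply`, `ineq86` (every printed
  input explicit), `B11Eq88Estimate.dstar73_sum_le`, `kernel3132_sum_le`.
* p. 291 (87)–(88) and L17–19 «Applying the inequalities (3.132) from [5], (55), (73) … (we put the constant a = 1), we can estimate this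
  functional derivative by O(1)ε₃²(Lʲη)⁻³ on Ω_j»: `B11Eq85FirstDerivative.inner87`, `inner87_adj`, `eq88_adj`, `hasFDerivAt88`,
  `B11Eq88Estimate.ineq88_term1`…`ineq88_term4`, `ineq88`; the Δ_πH₁-current files `B11Eq88LaplaceH1Identity.*`,
  `B11Eq88LaplaceH1CurrentNorm.*`, `B11Eq88KernelColumnsComposite.*`, `B11Eq88TransposeComposite.*`.
* p. 291 (89) «and can be estimated by O(1)ε₃³(Lʲη)⁻³ on Ω_j»: `B11Eq85FirstDerivative.inner89`, `hasFDerivAt89`,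
  `B11Eq88Estimate.phi89_term1`, `ineq89`.
* p. 291 (90) and L29–33 («st(b) denotes a set of plaquettes p such that b ⊂ ∂p»; «The derivative ((∂/∂A(b))V′₀)(A, ∂p) satisfies a
  bound similar to the bound (40) … with the power of |A| lower by 1 …»; «(90) can be estimated by O(1)ε₃²(ε₁ + ε₃)(Lʲη)⁻³ on Ω_j»):
  `B11Eq85FirstDerivative.hasFDerivAt90`, `ineq90`; `B11Eq90StB.st`, `card_st_le`, `deriv_V0_bond_eq_sum_st`, `norm_deriv_V0_bond_le`;
  `B11Eq90V0Derivative.norm_deriv_le_of_majorant40`, `ineq90_of_deriv40` (the «power lower by 1» sentence, Cauchy estimate);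
  `B11Eq90V0primeBond.*`, `B11Eq90V0primeCurrent.*`, `B11Eq90Transpose.*`, `B11Eq90Pullback.*`, `B11Eq90V0GroupComposed.curV0full`,
  `pair27_curV0full`.
* p. 292 L2–10 (the «primes»/A″ terms; «When we make the change of variables (47), we get many terms … easily estimated … if the covariant
  derivative in (39) acts on HD(A′)»; «the other terms are obtained by replacing some A′ in the commutator by −HD(A′)»): all HD(A′)-insertion
  terms at once as the pullback along (47): `B11Eq90V0GroupComposed.T47`, `analyticOnNhd_T47`, `curV0full`, `quadAnalytic_curV0full`.
* p. 292 (91)–(93) («typical term»; «three terms (92) … second and third terms are estimated easily by O(1)|DA′||A′|»; «integrating by parts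
  … ½D*Σi[A″, A″] (93)»): `B11Eq92ByParts.T91`, `eq91`, `hasDerivAt_T91`, `norm_summand92_le`, `fd93`, `byParts_92_93`,
  `hasDerivAt_T91_byParts`; `B11Eq85FirstDerivative.hasFDerivAt92`; `B11Eq92CommutatorFunctional.dTerm39Bond`, `sum_st_parti`,
  `opNorm_sum_dTerm39Bond_le`; `B11Eq93Commutator.eq91`, `fd93`.
* p. 292 (94)–(96) («by (1.50) of [6] (94)»; «these terms in (93) can be estimated by O(1)|∇A′||A′|»; «Applying D* to the first term gives
  (95)»; «the formula (1.52) from [6] (96)»; «(95) can be estimated by O(1)|∇A′||A′| also»): `B11Eq93Commutator.eq94`, `eq95`, `eq96`,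
  `fd95`, `fd93_sub_fd95`, `norm_fd93_sub_fd95_le`, `norm_fd95_le`, `norm_fd93_le`, `norm_fd93_le_eps3`; `B11Eq94CommutatorBond.comm2F`,
  `norm_covDstar_comm2F_le`; `B11Eq96CommutatorCurrent.curComm`, `est96_curComm`, `prop4Hyp_curComm`.
* pp. 292–293 PROPOSITION 4 (97)–(98) with «Gathering together all these estimates» and «The constants a₃, C₄ depend on d and L only»:
  row B11.Prop4 — `B11.Prop4Printed` (statement of record over `B11.LGData`; a₃, C₄ bound BEFORE the instance), `B11Prop6Scheme.Prop4Hyp`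
  (Fréchet form), `B11Smallness.prop4_gathering` (the constants' arithmetic), `B11Prop4Assembly.ineq97`, `ineq98`, `prop4Hyp`,
  `prop4Printed_of_termwise`, `B11Eq98CurrentSlot.norm_W80_le_sq`, `prop4Hyp_W80`, `B11Prop4ModelW80.prop4Printed_W80` (Prop. 4
  INHABITED at the concrete W = (δ/δA′)V), analyticity of the derivative `B11Eq80Current.differentiableOn_W80`, `analyticOnNhd_W80`.
* p. 293 (99)–(102) («Using (84) we get (99) … for all δA′ satisfying (100) … We take the operators H₁, 𝔓 defined by the operator Δ₁ …
  We make the translation A′ = A₁ + H₁B. Using the identity ⟨δA′, Δ₁H₁B⟩ = 0 … (101), (102)»): row B11.Eq99 —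
  `B11Eq101Translation.eq99_iff`, `inner_delta1_H1_eq_zero`, `eq101_of_eq99`, `eq99_of_eq101`, `eq102`; H₁ = `B11Eq129Minimizer.hOp`
  (`constraint_hOp`, `isMinOn_hOp`), constructed `B11Eq110GreenInverse.H1`, `Q_H1`, `laplaceA_H1`, complex/lattice
  `B11Eq103H1Complex.H1K`, `Q_H1K`, `H1LatticeK`, `H1CLM`; 𝔓 (L13–16 «an orthogonal projection … onto a subspace … QA′ = 0, RD*A′ = 0»):
  `B9Eq3147ProjectionOps.frakP`, `Q_frakP`, `RDstar_frakP`, `frakP_idem`, `B11Eq111FrakG.frakPLin`, `frakPLin_eq_self`, `frakPLin_idem`.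
* p. 293 (103) «2dLB₀C₁ε₁ < B₁C₁ε₁ < ε₃» and (104): the constant chain `B11Smallness.ineq103` (B₁ = 5dLB₀: `B11.B1_eq_B8Prop3`,
  ε₃ = 4B₁(ε₀ + C₁ε₁)); (104) «|A₁| < 2ε₃(Lʲη)⁻¹, |∇A₁| < 2ε₃(Lʲη)⁻²» = the conclusion `nMax U₀ A₁ < 2ε₃` of `B11.Prop5Printed`.
* pp. 293–294 (105)–(109) («By the definition of 𝔓 we obtain all the variations δA′ satisfying (102), if we take δA′ = 𝔓δA … (105),
  (106), (107) … (108), (109). They are equivalent to Eqs. (101), (102)»): row B11.Eq105 — `B11Eq111FrakG.mem_range_frakPLin_iff` (range 𝔓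
  = {QA′ = 0, RD*A′ = 0}), `B11Eq108Reduction.eq105`, `eq106`, `eq107`, `eq101_vector_iff`, `eq108_of_eq101`, `eq101_of_eq108`,
  `eq108_iff_eq101`.
* p. 294 (110)–(111) («We denote by G₁ an inverse operator to the operator Δ₁ + DRD* + aQ*Q. Obviously we have Δ₁A₁ = G₁⁻¹A₁ and Eq.
  (108) implies (110). In [5] we have proved that the operator G₁𝔓* is equal to the operator 𝔊 defined by (3.148) and satisfying the
  equalities Q𝔊 = 0, RD*𝔊 = 0. Thus any solution of (110) satisfies automatically Eq. (108), (109) … (111)»):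
  `B11Eq108Reduction.laplaceA_apply_of_mem` («Δ₁A₁ = G₁⁻¹A₁» on the constraint space), `eq110_of_eq108`, `padj_laplaceA`,
  `frakG_eq_proj_comp` (G₁𝔓* = 𝔓G₁ = 𝔊), `frakG_mem` (Q𝔊 = 0, RD*𝔊 = 0), `eq108_109_of_eq110`, `eq111_iff_eq110`, `eq111_iff_eq101`;
  G₁ constructed `B11Eq110GreenInverse.G1`, `laplaceA_G1`, `B11Eq103H1Complex.G1K`, `laplaceAK_G1K`; 𝔊: `B9Eq3147ProjectionOps.frakG`,
  `Q_frakG`, `RDstar_frakG`, `B11Eq111FrakG.frakGLin`, `apply_Q_frakGLin`, `apply_RDstar_frakGLin`, `frakG`, `frakG_mem_constraint102`,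
  `B11Eq103H1Complex.frakGLatticeK`; [5] (3.148)–(3.153) / Thms 3.12–3.13: `B9.Thm312_313Printed`; the whole chain (82) ⇔ (111):
  `B11Prop5Model.critical82_iff_eq111`; (111) as the carrier predicate `B11.LGData.Sol111`.
* p. 294 PROPOSITION 5 (111)–(112): row B11.Prop5 — `B11.Prop5Printed` (statement of record), `B11Prop5Model.prop5Printed_model`
  (inhabited for the linearized-coordinate model family); (112) = `B11.LGData.T112`; its use on p. 296 `B11.axial_critical_from_one_landau`.
* p. 294 (113)–(114): row B11.Eq113 — `B11Smallness.ineq113_of_114` ((114) satisfies (113)), `B11.ineq122` (p. 296), the choice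
  ε₃ = 4ε₂ = 4B₁(ε₀ + C₁ε₁) as used by `B11GlobalMin.ChartCovers` (docstring) and `B11.axial_critical_from_one_landau`.

## WHAT THIS FILE ADDS (residual printed sentences with no declaration; hypothesis form; and the bundle)

* `SectDData` — the carrier `B11.LGData` (Sects. A–E letters, `…B11`) EXTENDED by the six letters Sect. D names and `LGData` lacks:
  `expEta` (U₁ = e^{iηA}, (19)/(22)), `In75_76` ((75)–(76)), `CritF` («critical configuration of the functional 𝔉 considered on
  configurations A′ satisfying (75)–(77)», (82)–(83)), `VAnalytic` (p. 290 L22), `H1B` and `transl` (p. 293 «the translation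
  A′ = A₁ + H₁B»); `SectDData.InChart` = (75)–(77) at parameter ε₃.  No law is imposed on the letters (house style of `…B11`).
* `ChartReductionPrinted` — p. 290 L3–7 «We assume that ε₃ is so small that … We assume also that ε₂ ≦ ¼ε₃, hence by Proposition 2 it
  is enough to prove that the functional 𝔉 considered on configurations A′ satisfying (75)–(77) has exactly one critical
  configuration.», typed in the obtainability shape print gives this reduction in Proposition 5 («can be obtained from … by the
  transformation»): every critical U₁ of A(U₁U₀) in (19)–(21) [ε₂] is e^{iη(A′ − HD(A′))} for a critical A′ of 𝔉 in (75)–(77) [ε₃];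
  `unique19_21_of_uniqueChart` (kernel): hence «at most one critical A′ in the chart ⇒ at most one critical U₁ in (19)–(21)», which with
  `B11.Prop2Printed` (block 11) gives `axialCritical_related_of_uniqueChart` — what «it is enough» delivers for uniqueness.
* `V80AnalyticPrinted` — p. 290 L22 «It [V(A′) of (80)] is analytic in A′ for A′ with values in the complexified algebra and satisfying
  (77).» (the tree proves analyticity of the DERIVATIVE W = (δ/δA′)V, `B11Eq80Current.analyticOnNhd_W80`, which is Proposition 4's
  clause; the sentence on V itself had no declaration).
* `Ineq103H1BPrinted` — p. 293 (103), the BOUND ON H₁B «|H₁B| < B₀2dLC₁ε₁(Lʲη)⁻¹, |∇H₁B| < B₀2dLC₁ε₁(Lʲη)⁻² on Ω_j» (the tree had the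
  constant chain `B11Smallness.ineq103` and the label `B11.LGData.LikeH1B` «satisfies the same bounds (103) as H₁B», not the bound on
  H₁B itself).
* `TranslationRangePrinted` — p. 293 L24–29 «so A₁ satisfies (104). Thus the set of configurations A′ restricted by (77) is contained in
  the range of the translation A′ = A₁ + H₁B, defined on the set of A₁ restricted by (104). Let us notice that if we take all A₁
  satisfying (104), then the image of the translation is contained in the set of A′ satisfying (77) with 3ε₃ instead of ε₃.»; its
  content PROVED in any normed model (`translationRange_model`, triangle inequality) and for every member whose size is subadditive
  and whose translation is A₁ ↦ A₁ + H₁B (`translationRangePrinted_of_subadditive`).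
* `eq76_first` — the first equality of (76) «RD*(A′ − HD(A′)) = RD*A′» PROVED from (45) «RD*HB = 0» (p. 285) for linear R, D*, H.
* `best_restrictions_114`, `restriction_transfer_114` — p. 294 L26–30 «We get best restrictions on ε₀, ε₁ (i.e. largest constants
  a₀, a₁) if we take (114) … Restrictions on ε₃ are transformed into restrictions on ε₀, ε₁.» as real arithmetic: under (113) every
  admissible ε₃ is ≥ 4B₁(ε₀ + C₁ε₁), so a restriction «ε₃ ≤ c» is available for (ε₀, ε₁) iff 4B₁(ε₀ + C₁ε₁) ≤ c.
* `Hyp` (full name `…B11Carve13SectDHyp.Hyp`) — THE BUNDLE keyed to the consumer: `B11.Prop3Printed ∧ ChartReductionPrinted ∧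
  V80AnalyticPrinted ∧ B11.Prop4Printed ∧ Ineq103H1BPrinted ∧ TranslationRangePrinted ∧ B11.Prop5Printed` over ONE family
  `fam : I → SectDData` with shared constants (C₁, B₃ of (14); B₁ of [6] Thm 2 / (19), (103), (113); B₀ of [5] Thm 3.12 in (46), (71),
  (103); C₂, C₃, c₄ of [4]; c₁(½), δ₀ of [3]); accessors and the derived `Hyp.unique19_21`, `Hyp.translation_range`,
  `Hyp.prop4_on_translation` (p. 293 L29–31 «All the representations and the estimates obtained up to now hold in this situation also, if
  we impose correspondingly stronger restrictions on ε₃ and change the constants» INSTANTIATED for (98): on the translation image,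
  3ε₃ ≤ a₃ suffices).  A node prover takes `(h : Hyp C₁ B₃ B₁ B₀ C₂ C₃ c1h c₄ δ₀ fam)`.

## HONEST SCOPE / NOT TYPED

(i) The standing assumption p. 290 L3–5 «ε₃ is so small that the range of the transformation (47) is contained in the set of
configurations A for which the representations and the inequalities of the previous sections hold» is a THRESHOLD; it is the `∃ c, … ε₃ ≤ c`
(resp. `ε₁ ≤ c`) of each typed statement, exactly as `B11.Prop4Printed`/`B11.Prop5Printed` display «sufficiently small».  (ii) «by
Proposition 2 it is enough»: Proposition 2 (`B11.Prop2Printed`, block 11) carries critical configurations in (19)–(21) to the critical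
orbits of (5) in (6) (p. 281 L24–26 «We will prove that for ε₁, ε₂ sufficiently small there exists exactly one critical configuration»);
the clause «ε₂ ≦ ¼ε₃» is Proposition 3's range condition.  `ChartReductionPrinted` types the obtainability direction only — the one the
paper's own summary (Prop. 5) prints and the one the paper USES (p. 296 L10–12 «If we take ε₄ = 8ε₂, and if we assume 8ε₂ ≦ a₄ and
2B₀C₁B₃ε₁ ≦ 8ε₂, then by Propositions 5 and 6 there is at most one critical configuration of (5) in (19)–(21)», tree
`B11.axial_critical_from_one_landau`); EXISTENCE of a critical configuration in (19)–(21) is obtained in print separately (p. 296 L21–31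
«Equation (111) has a solution belonging to the space (115) with ε₄ = 2B₀C₁B₃ε₁ … This gives us a critical configuration U₁ satisfying
almost all conditions (19)–(21), except the bounds for the second order operators in (19) …», constants `B11.eps4_existence_bound`), not
from this sentence, and is not typed here.  (iii) `VAnalytic`, `CritF`, `In75_76`, `H1B`, `transl`, `expEta` are LETTERS (names), as all of `B11.LGData`; their
concrete readings live in `B11Prop5Model` (M1)–(M4), `B11Prop7Model.ChartDatum`, `B11Eq80Current.V80`, `B11Eq129Minimizer.hOp`,
`B11Eq103H1Complex.H1CLM`; no law between `transl`/`H1B`/`nMax` is asserted — `translationRangePrinted_of_subadditive` shows which laws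
make `TranslationRangePrinted` a theorem.  (iv) The termwise O(1)-sentences of pp. 291–292 are all cited above, not re-typed; the located
reading notes of these pages are inherited, not re-adjudicated (cell GAPS G-B11-C1 complex arguments of [4] Props 4/5, C-B11-D1R the edge
to [5] Sect. D, G-B11-E5/E5R local vs global minimum, DIVERGENCE D-B11-3 «absolute» = (d, L)-dependent).  (v) No instance, no notation,
no `sorry`; axioms standard.  Nothing here proves a summit statement or bears on the Clay problem; the node count does not move.
-/

namespace Literature.MathematicalPhysics.QuantumFieldTheory.Balaban1983to89.B11Carve13SectDHyp

variable {I : Type}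

/-! ## §1 The carrier: `B11.LGData` extended by the letters of Sect. D -/

/-- The Landau-gauge carrier `B11.LGData` of Sects. A–E (configurations U₀ `Cfg`, data V `Bdry`, perturbations U₁ `Pert`,
𝔤ᶜ-valued fields A′, A₁ `Fld`, with `Sat14` (14), `In19_21` (19)–(21), `CritL`, `T47` (47), `nMax` = max{|·|₍₋₁₎, |∇·|₍₋₂₎},
`dVn`, `Sol111`, `T112`, …) EXTENDED by the letters Sect. D (pp. 289–294) names and `LGData` does not carry:
* `expEta A` = the configuration U₁ = e^{iηA} (p. 281 (19), (22): «U₁ = e^{iηA}»), so that the change of variables of p. 289 L30–31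
  «We make the change of variables (47) and we consider the functional (74)» reads U₁ = `expEta (T47 U₀ A′)` = exp iη(A′ − HD(A′));
* `In75_76 V U₀ A′` = A′ satisfies (75) «LʲηQ_jA′ = B on Λ_j, j = 0, 1, …, k, |B| < 2dLC₁ε₁» (B the datum of (20), «given by the
  formulas (1.31) in [6]») and (76) «RD*(A′ − HD(A′)) = RD*A′ = 0»;
* `CritF V U₀ A′` = «A′ is a critical configuration of the functional 𝔉 [(74) = (81)] considered on configurations A′ satisfying
  (75)–(77)», i.e. (82) «⟨(δ/δA′)𝔉(A′), δA′⟩ = 0 holds for all δA′ in the tangent space, that is δA′ satisfying (83) QδA′ = 0,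
  RD*δA′ = 0» (p. 290);
* `VAnalytic U₀ ε` = «[V(A′) of (80)] is analytic in A′ for A′ with values in the complexified algebra and satisfying (77)» at
  parameter ε (p. 290 L22);
* `H1B V U₀` = the configuration H₁B of p. 293 (H₁ «defined by the operator Δ₁», B the datum of (75)); `transl V U₀ A₁` = the
  translated field A′ = A₁ + H₁B (p. 293 L16 «We make the translation A′ = A₁ + H₁B»).
No law between the letters is part of the structure (house style of `B11.LGData`; readings: `B11Prop5Model`, `B11Prop7Model`).
[cite: Balaban1985Variational, (74)–(77) pp.289–290, (82)–(83) p.290, (103)–(104) p.293] -/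
structure SectDData extends B11.LGData where
  expEta : Fld → Pert
  In75_76 : Bdry → Cfg → Fld → Prop
  CritF : Bdry → Cfg → Fld → Prop
  VAnalytic : Cfg → ℝ → Prop
  H1B : Bdry → Cfg → Fld
  transl : Bdry → Cfg → Fld → Fld

/-- **The space (75)–(77) at parameter ε₃** (p. 289 L33 – p. 290 L2, verbatim): *"on the space of field configurations A′ satisfying
LʲηQ_jA′ = B on Λ_j, j = 0, 1, …, k, |B| < 2dLC₁ε₁, (75) RD*(A′ − HD(A′)) = RD*A′ = 0, (76) |A′| < ε₃(Lʲη)⁻¹, |∇A′| < ε₃(Lʲη)⁻² on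
Ω_j, j = 0, 1, …, k. (77)"* — (75)–(76) by the letter `In75_76`, (77) by the carrier size `nMax` («i.e. max{|A′|₍₋₁₎, |∇A′|₍₋₂₎} < ε₃»,
Prop. 4). [cite: Balaban1985Variational, (75)–(77) pp.289–290] -/
def SectDData.InChart (X : SectDData) (ε₃ : ℝ) (V : X.Bdry) (U₀ : X.Cfg) (A' : X.Fld) : Prop :=
  X.In75_76 V U₀ A' ∧ X.nMax U₀ A' < ε₃

/-- Unfolding of `InChart`. [cite: Balaban1985Variational, (75)–(77) pp.289–290] -/
theorem SectDData.inChart_iff (X : SectDData) (ε₃ : ℝ) (V : X.Bdry) (U₀ : X.Cfg) (A' : X.Fld) :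
    X.InChart ε₃ V U₀ A' ↔ X.In75_76 V U₀ A' ∧ X.nMax U₀ A' < ε₃ := Iff.rfl

/-- (77) is monotone in its parameter: the chart at ε₃ is contained in the chart at any ε₃′ ≥ ε₃ (used for «(77) with 3ε₃ instead of
ε₃», p. 293). [cite: Balaban1985Variational, (77) p.290, p.293 L27–29] -/
theorem SectDData.inChart_mono (X : SectDData) {ε₃ ε₃' : ℝ} (h : ε₃ ≤ ε₃') (V : X.Bdry) (U₀ : X.Cfg) (A' : X.Fld)
    (hA : X.InChart ε₃ V U₀ A') : X.InChart ε₃' V U₀ A' :=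
  ⟨hA.1, lt_of_lt_of_le hA.2 h⟩

/-! ## §2 p. 290: the reduction to the chart, and the analyticity of `V` -/

/-- **The reduction of Sect. D to the chart** (p. 290 [PDF 14] L3–7, verbatim): *"We assume that ε₃ is so small that the range of
the transformation (47) is contained in the set of configurations A for which the representations and the inequalities of the
previous sections hold. We assume also that ε₂ ≦ ¼ε₃, hence by Proposition 2 it is enough to prove that the functional 𝔉
considered on configurations A′ satisfying (75)–(77) has exactly one critical configuration."* — with p. 289 L30–31 *"We make the
change of variables (47) and we consider the functional (74)"* and the programme of p. 281 L24–26 *"We will prove that for ε₁, ε₂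
sufficiently small there exists exactly one critical configuration"* [of A(U₁U₀) in the space (19)–(21)].  TYPED in the
obtainability shape in which print states this reduction in Proposition 5 («All critical configurations U₁ of the functional
A(U₁U₀) in the space defined by (19)–(21) … can be obtained from … by the transformation …»): for U₀ with (14), ε₂ ≦ ¼ε₃ and ε₃ below
a threshold (the «so small that» of L3), every critical configuration U₁ of A(U₁U₀) in (19)–(21) [parameter ε₂] is
U₁ = exp iη(A′ − HD(A′)) = `expEta (T47 U₀ A′)` for some critical configuration A′ of 𝔉 in the space (75)–(77) [parameter ε₃]
(Proposition 3: the range of (47) on that space contains the set (43) with ε₂ ≦ ¼ε₃).  Consequently uniqueness on the chart gives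
uniqueness in (19)–(21) (`unique19_21_of_uniqueChart`); existence at a given ε₂ is p. 296's business (module docstring (ii)).
[cite: Balaban1985Variational, p.290 L3–7 (after (77)); p.289 L30–31; Prop. 3 p.289; p.281 L24–26] -/
def ChartReductionPrinted (C₁ B₃ : ℝ) (fam : I → SectDData) : Prop :=
  ∃ c : ℝ, 0 < c ∧ ∀ i : I, ∀ ε₁ ε₂ ε₃ : ℝ, 0 < ε₁ → 0 < ε₃ → ε₂ ≤ ε₃ / 4 → ε₃ ≤ c →
    ∀ V : (fam i).Bdry, ∀ U₀ : (fam i).Cfg, (fam i).Sat14 (C₁ * B₃ * ε₁) (C₁ * ε₁) V U₀ →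
      ∀ U₁ : (fam i).Pert, (fam i).In19_21 ε₂ V U₀ U₁ → (fam i).CritL V U₀ U₁ →
        ∃ A' : (fam i).Fld, (fam i).InChart ε₃ V U₀ A' ∧ (fam i).CritF V U₀ A' ∧
          (fam i).expEta ((fam i).T47 U₀ A') = U₁

/-- **What «it is enough» delivers** (kernel bookkeeping for p. 290 L5–7): under `ChartReductionPrinted`, if the functional 𝔉 on the
space (75)–(77) [ε₃] has AT MOST ONE critical configuration, then A(U₁U₀) has at most one critical configuration in (19)–(21) [ε₂],
ε₂ ≦ ¼ε₃. [cite: Balaban1985Variational, p.290 L3–7 (bookkeeping)] -/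
theorem unique19_21_of_uniqueChart {C₁ B₃ : ℝ} {fam : I → SectDData} (hR : ChartReductionPrinted C₁ B₃ fam) :
    ∃ c : ℝ, 0 < c ∧ ∀ i : I, ∀ ε₁ ε₂ ε₃ : ℝ, 0 < ε₁ → 0 < ε₃ → ε₂ ≤ ε₃ / 4 → ε₃ ≤ c →
      ∀ V : (fam i).Bdry, ∀ U₀ : (fam i).Cfg, (fam i).Sat14 (C₁ * B₃ * ε₁) (C₁ * ε₁) V U₀ →
        (∀ A' A'' : (fam i).Fld, (fam i).InChart ε₃ V U₀ A' → (fam i).CritF V U₀ A' →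
          (fam i).InChart ε₃ V U₀ A'' → (fam i).CritF V U₀ A'' → A' = A'') →
        ∀ U₁ U₁' : (fam i).Pert, (fam i).In19_21 ε₂ V U₀ U₁ → (fam i).CritL V U₀ U₁ →
          (fam i).In19_21 ε₂ V U₀ U₁' → (fam i).CritL V U₀ U₁' → U₁ = U₁' := by
  obtain ⟨c, hc, H⟩ := hR
  refine ⟨c, hc, fun i ε₁ ε₂ ε₃ h1 h3 h23 h3c V U₀ h14 huniq U₁ U₁' hU hcU hU' hcU' => ?_⟩
  obtain ⟨A', hA', hcA', hexp⟩ := H i ε₁ ε₂ ε₃ h1 h3 h23 h3c V U₀ h14 U₁ hU hcU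
  obtain ⟨A'', hA'', hcA'', hexp'⟩ := H i ε₁ ε₂ ε₃ h1 h3 h23 h3c V U₀ h14 U₁' hU' hcU'
  have hAA : A' = A'' := huniq A' A'' hA' hcA' hA'' hcA''
  rw [← hexp, ← hexp', hAA]

/-- **… composed with Proposition 2** (p. 290 L6 «by Proposition 2», `B11.Prop2Printed` of block 11 on the same family): if 𝔉 has at
most one critical configuration on the chart [ε₃], then any two critical configurations U′, U″ of the functional (5) in the axial-gauge
space (18) are restricted-gauge transforms (u with R̄₀uʲ = 1) of ONE critical U₁ of A(U₁U₀) in (19)–(21) — «at most one critical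
orbit», for ε₀ + C₁ε₁ ≤ c₁, B₁(ε₀ + C₁ε₁) ≤ ε₂ ≦ ¼ε₃, ε₃ below the threshold.  (Same conclusion shape as the p. 296 bookkeeping
`B11.axial_critical_from_one_landau`, which uses Props 5–6 instead of the chart hypothesis.)
[cite: Balaban1985Variational, p.290 L3–7 with Prop. 2 p.281 (bookkeeping)] -/
theorem axialCritical_related_of_uniqueChart {C₁ B₃ B₁ c₁ : ℝ} {fam : I → SectDData}
    (hR : ChartReductionPrinted C₁ B₃ fam) (h2 : B11.Prop2Printed B₁ B₃ C₁ c₁ (fun i => (fam i).toLGData)) :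
    ∃ c : ℝ, 0 < c ∧ ∀ i : I, ∀ ε₀ ε₁ ε₂ ε₃ : ℝ, 0 < ε₀ → 0 < ε₁ → ε₀ + C₁ * ε₁ ≤ c₁ →
      B₁ * (ε₀ + C₁ * ε₁) ≤ ε₂ → 0 < ε₃ → ε₂ ≤ ε₃ / 4 → ε₃ ≤ c →
      ∀ V : (fam i).Bdry, ∀ U₀ : (fam i).Cfg, (fam i).Sat14 (C₁ * B₃ * ε₁) (C₁ * ε₁) V U₀ →
        (∀ A' A'' : (fam i).Fld, (fam i).InChart ε₃ V U₀ A' → (fam i).CritF V U₀ A' →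
          (fam i).InChart ε₃ V U₀ A'' → (fam i).CritF V U₀ A'' → A' = A'') →
        ∀ U' U'' : (fam i).Pert, (fam i).In18 ε₀ V U₀ U' → (fam i).Crit V U₀ U' →
          (fam i).In18 ε₀ V U₀ U'' → (fam i).Crit V U₀ U'' →
            ∃ U₁ : (fam i).Pert, ∃ u u' : (fam i).GT, (fam i).In19_21 ε₂ V U₀ U₁ ∧ (fam i).CritL V U₀ U₁ ∧
              (fam i).Restricted U₀ u ∧ (fam i).Restricted U₀ u' ∧
              (fam i).toAxial U₀ U₁ u = U' ∧ (fam i).toAxial U₀ U₁ u' = U'' := by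
  obtain ⟨c, hc, H⟩ := unique19_21_of_uniqueChart hR
  refine ⟨c, hc, fun i ε₀ ε₁ ε₂ ε₃ h0 h1 hs hB₁ h3 h23 h3c V U₀ h14 huniq U' U'' hU' hcU' hU'' hcU'' => ?_⟩
  obtain ⟨u, U₁, hu, h19, hcrit, hax⟩ := h2 i ε₀ ε₁ ε₂ h0 h1 hs hB₁ V U₀ h14 U' hU' hcU'
  obtain ⟨u', U₁', hu', h19', hcrit', hax'⟩ := h2 i ε₀ ε₁ ε₂ h0 h1 hs hB₁ V U₀ h14 U'' hU'' hcU''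
  have hU : U₁ = U₁' := H i ε₁ ε₂ ε₃ h1 h3 h23 h3c V U₀ h14 huniq U₁ U₁' h19 hcrit h19' hcrit'
  exact ⟨U₁, u, u', h19, hcrit, hu, hu', hax, hU ▸ hax'⟩

/-- **Analyticity of `V`** (p. 290 [PDF 14] L19–22, verbatim): *"Now let us write higher order terms. They determine the functional
V(A′) = −⟨HD₃(A′), J⟩ − ⟨A′, Δ_πHD(A′)⟩ + ½⟨HD(A′), Δ_πHD(A′)⟩ + V₀(A′ − HD(A′)). (80)  It is analytic in A′ for A′ with values in
the complexified algebra and satisfying (77)."* — for U₀ with (14) and ε₃ below the standing threshold of p. 290 L3 («ε₃ is so small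
that …»), V is analytic on {𝔤ᶜ-valued A′ with (77) at ε₃} (letter `VAnalytic`).  (The derivative's analyticity is Proposition 4's
clause, `B11.LGData.dVAnalytic` / `B11Eq80Current.analyticOnNhd_W80`; concrete V = `B11Eq80Current.V80`.)
[cite: Balaban1985Variational, p.290 L22 (after (80))] -/
def V80AnalyticPrinted (C₁ B₃ : ℝ) (fam : I → SectDData) : Prop :=
  ∃ c : ℝ, 0 < c ∧ ∀ i : I, ∀ ε₁ ε₃ : ℝ, 0 < ε₁ → 0 < ε₃ → ε₃ ≤ c →
    ∀ V : (fam i).Bdry, ∀ U₀ : (fam i).Cfg, (fam i).Sat14 (C₁ * B₃ * ε₁) (C₁ * ε₁) V U₀ →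
      (fam i).VAnalytic U₀ ε₃

/-- The first equality displayed in (76), «RD*(A′ − HD(A′)) = RD*A′», is the property (45) p. 285 «RD*HB = 0» of H together with the
linearity of R, D* — PROVED abstractly (R, D*, H linear over any semiring, D an arbitrary map A′ ↦ D(A′)).
[cite: Balaban1985Variational, (76) p.289 with (45) p.285] -/
theorem eq76_first {𝕜 : Type*} [Semiring 𝕜] {E F S : Type*} [AddCommGroup E] [Module 𝕜 E] [AddCommGroup F] [Module 𝕜 F]
    [AddCommGroup S] [Module 𝕜 S] (R : S →ₗ[𝕜] S) (Dstar : E →ₗ[𝕜] S) (H : F →ₗ[𝕜] E) (D : E → F)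
    (h45 : ∀ B : F, R (Dstar (H B)) = 0) (A' : E) :
    R (Dstar (A' - H (D A'))) = R (Dstar A') := by
  rw [map_sub, map_sub, h45, sub_zero]

/-! ## §3 p. 293: the bound (103) on `H₁B` and the range of the translation `A′ = A₁ + H₁B` -/

/-- **(103), the bound on H₁B** (p. 293 [PDF 17] L21–23, verbatim): *"Because the regularity conditions (77) hold for A′, and
|H₁B| < B₀2dLC₁ε₁(Lʲη)⁻¹, |∇H₁B| < B₀2dLC₁ε₁(Lʲη)⁻² on Ω_j, 2dLB₀C₁ε₁ < B₁C₁ε₁ < ε₃, (103)"* — the two bounds on H₁B, i.e.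
max{|H₁B|₍₋₁₎, |∇H₁B|₍₋₂₎} < 2dLB₀C₁ε₁ in the carrier size `nMax`, for U₀ with (14) (so |B| < 2dLC₁ε₁, (20)/(75)) and ε₁ below the
standing threshold (B₀ = the bound of [5] Thm 3.12 for H₁, cf. (46) «|HB| ≦ B₀(Lʲη)⁻¹|B|, |∇HB| ≦ B₀(Lʲη)⁻²|B|» p. 285; d, L = the
member's `dim`, `L`).  The constant chain «2dLB₀C₁ε₁ < B₁C₁ε₁ < ε₃» is `B11Smallness.ineq103` (B₁ = 5dLB₀, ε₃ = 4B₁(ε₀ + C₁ε₁)).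
[cite: Balaban1985Variational, (103) p.293; (46) p.285] -/
def Ineq103H1BPrinted (B₀ C₁ B₃ : ℝ) (fam : I → SectDData) : Prop :=
  ∃ c : ℝ, 0 < c ∧ ∀ i : I, ∀ ε₁ : ℝ, 0 < ε₁ → ε₁ ≤ c →
    ∀ V : (fam i).Bdry, ∀ U₀ : (fam i).Cfg, (fam i).Sat14 (C₁ * B₃ * ε₁) (C₁ * ε₁) V U₀ →
      (fam i).nMax U₀ ((fam i).H1B V U₀) < 2 * (fam i).dim * (fam i).L * B₀ * C₁ * ε₁

/-- **The range of the translation A′ = A₁ + H₁B** (p. 293 [PDF 17] L21–29, verbatim): *"Because the regularity conditions (77) hold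
for A′, and [(103)], so A₁ satisfies |A₁| < 2ε₃(Lʲη)⁻¹, |∇A₁| < 2ε₃(Lʲη)⁻². (104)  Thus the set of configurations A′ restricted by
(77) is contained in the range of the translation A′ = A₁ + H₁B, defined on the set of A₁ restricted by (104). Let us notice that if
we take all A₁ satisfying (104), then the image of the translation is contained in the set of A′ satisfying (77) with 3ε₃ instead of
ε₃."* — for U₀ with (14), GIVEN the two bounds of (103) on H₁B and its constant chain 2dLB₀C₁ε₁ < B₁C₁ε₁ < ε₃: (a) every A′ with (77)
[ε₃] is `transl V U₀ A₁` for some A₁ with (104) [2ε₃]; (b) for every A₁ with (104) the translate satisfies (77) with 3ε₃.  Content =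
the triangle inequality for the size max{|·|₍₋₁₎, |∇·|₍₋₂₎} (`translationRange_model`, `translationRangePrinted_of_subadditive`).
[cite: Balaban1985Variational, (103)–(104) p.293 and L26–29] -/
def TranslationRangePrinted (B₀ B₁ C₁ B₃ : ℝ) (fam : I → SectDData) : Prop :=
  ∀ i : I, ∀ ε₁ ε₃ : ℝ, 0 < ε₁ →
    2 * (fam i).dim * (fam i).L * B₀ * C₁ * ε₁ < B₁ * C₁ * ε₁ → B₁ * C₁ * ε₁ < ε₃ →
    ∀ V : (fam i).Bdry, ∀ U₀ : (fam i).Cfg, (fam i).Sat14 (C₁ * B₃ * ε₁) (C₁ * ε₁) V U₀ →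
      (fam i).nMax U₀ ((fam i).H1B V U₀) < 2 * (fam i).dim * (fam i).L * B₀ * C₁ * ε₁ →
      (∀ A' : (fam i).Fld, (fam i).nMax U₀ A' < ε₃ →
        ∃ A₁ : (fam i).Fld, (fam i).nMax U₀ A₁ < 2 * ε₃ ∧ (fam i).transl V U₀ A₁ = A') ∧
      (∀ A₁ : (fam i).Fld, (fam i).nMax U₀ A₁ < 2 * ε₃ → (fam i).nMax U₀ ((fam i).transl V U₀ A₁) < 3 * ε₃)

/-- **The content of the translation-range sentences, PROVED in any seminormed group** (print's (77)/(104) sizes are sup norms): if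
‖h‖ < ε₃ (h = H₁B, by (103)), then every A′ with ‖A′‖ < ε₃ is A₁ + h with ‖A₁‖ < 2ε₃ (take A₁ = A′ − h), and ‖A₁ + h‖ < 3ε₃ whenever
‖A₁‖ < 2ε₃. [cite: Balaban1985Variational, (104) p.293 and L26–29 (triangle inequality)] -/
theorem translationRange_model {E : Type*} [SeminormedAddCommGroup E] (h : E) {ε₃ : ℝ} (hh : ‖h‖ < ε₃) :
    (∀ A' : E, ‖A'‖ < ε₃ → ∃ A₁ : E, ‖A₁‖ < 2 * ε₃ ∧ A₁ + h = A') ∧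
    (∀ A₁ : E, ‖A₁‖ < 2 * ε₃ → ‖A₁ + h‖ < 3 * ε₃) := by
  refine ⟨fun A' hA' => ⟨A' - h, ?_, sub_add_cancel A' h⟩, fun A₁ hA₁ => ?_⟩
  · calc ‖A' - h‖ ≤ ‖A'‖ + ‖h‖ := norm_sub_le _ _
      _ < ε₃ + ε₃ := add_lt_add hA' hh
      _ = 2 * ε₃ := by ring
  · calc ‖A₁ + h‖ ≤ ‖A₁‖ + ‖h‖ := norm_add_le _ _
      _ < 2 * ε₃ + ε₃ := add_lt_add hA₁ hh
      _ = 3 * ε₃ := by ring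

/-- **`TranslationRangePrinted` is a theorem for every family whose letters obey the evident laws**: the fields form an additive group,
the size `nMax U₀` is subadditive under sums and differences (a sup of seminorms), and `transl V U₀ A₁ = A₁ + H1B V U₀`.  (The
hypothesis-form statement asserts no law; this records which laws make it hold.  The additive-group structure of the fields is an
EXPLICIT argument `addGroup` — a hypothesis of this theorem, not an instance declaration.)
[cite: Balaban1985Variational, (103)–(104) p.293 and L26–29 (triangle inequality)] -/
theorem translationRangePrinted_of_subadditive (B₀ B₁ C₁ B₃ : ℝ) (fam : I → SectDData)
    (addGroup : ∀ i, AddCommGroup (fam i).Fld)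
    (hadd : ∀ (i : I) (U₀ : (fam i).Cfg) (A A₂ : (fam i).Fld),
      (fam i).nMax U₀ (A + A₂) ≤ (fam i).nMax U₀ A + (fam i).nMax U₀ A₂)
    (hsub : ∀ (i : I) (U₀ : (fam i).Cfg) (A A₂ : (fam i).Fld),
      (fam i).nMax U₀ (A - A₂) ≤ (fam i).nMax U₀ A + (fam i).nMax U₀ A₂)
    (htr : ∀ (i : I) (V : (fam i).Bdry) (U₀ : (fam i).Cfg) (A₁ : (fam i).Fld),
      (fam i).transl V U₀ A₁ = A₁ + (fam i).H1B V U₀) :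
    TranslationRangePrinted B₀ B₁ C₁ B₃ fam := by
  intro i ε₁ ε₃ _hε₁ hch₁ hch₂ V U₀ _h14 hH
  have hHε : (fam i).nMax U₀ ((fam i).H1B V U₀) < ε₃ := lt_trans (lt_trans hH hch₁) hch₂
  refine ⟨fun A' hA' => ⟨A' - (fam i).H1B V U₀, ?_, ?_⟩, fun A₁ hA₁ => ?_⟩
  · have := hsub i U₀ A' ((fam i).H1B V U₀)
    linarith
  · rw [htr, sub_add_cancel]
  · rw [htr]
    have := hadd i U₀ A₁ ((fam i).H1B V U₀)
    linarith

/-! ## §4 p. 294: the remarks on the constants (113)–(114) -/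

/-- **«best restrictions»** (p. 294 [PDF 18] L23–28, verbatim): *"Let us make some remarks about the constants ε₀, ε₁, ε₂, ε₃. In the
previous sections they were independent, although restricted by the conditions: B₃ε₁ ≦ ε₀, B₁(ε₀ + C₁ε₁) ≦ ε₂, ε₂ ≦ ¼ε₃, (113)
ε₃ sufficiently small. We get best restrictions on ε₀, ε₁ (i.e. largest constants a₀, a₁) if we take ε₂ = B₁(ε₀ + C₁ε₁), ε₃ = 4ε₂ =
4B₁(ε₀ + C₁ε₁). (114)"* — as arithmetic: a restriction «ε₃ ≤ c» is available for given (ε₀, ε₁) under the last two members of (113)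
for SOME choice of ε₂, ε₃ iff it holds for the choice (114), i.e. iff 4B₁(ε₀ + C₁ε₁) ≤ c (the (114) values are the least admissible
ones; that (114) satisfies (113) is `B11Smallness.ineq113_of_114`). [cite: Balaban1985Variational, (113)–(114) p.294 (arithmetic)] -/
theorem best_restrictions_114 (B₁ C₁ ε₀ ε₁ c : ℝ) :
    (∃ ε₂ ε₃ : ℝ, B₁ * (ε₀ + C₁ * ε₁) ≤ ε₂ ∧ ε₂ ≤ ε₃ / 4 ∧ ε₃ ≤ c) ↔ 4 * B₁ * (ε₀ + C₁ * ε₁) ≤ c := by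
  constructor
  · rintro ⟨ε₂, ε₃, h₂, h₃, hc⟩
    linarith
  · intro h
    refine ⟨B₁ * (ε₀ + C₁ * ε₁), 4 * (B₁ * (ε₀ + C₁ * ε₁)), le_rfl, by linarith, by linarith⟩

/-- **«Restrictions on ε₃ are transformed into restrictions on ε₀, ε₁»** (p. 294 L29–30): under the choice (114) a restriction ε₃ ≤ c
IS the restriction 4B₁(ε₀ + C₁ε₁) ≤ c on ε₀, ε₁; and any ε₃ admissible under (113) dominates the (114) value.
[cite: Balaban1985Variational, (113)–(114) p.294 and L29–30 (arithmetic)] -/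
theorem restriction_transfer_114 (B₁ C₁ ε₀ ε₁ ε₂ ε₃ c : ℝ) :
    (ε₃ = 4 * B₁ * (ε₀ + C₁ * ε₁) → (ε₃ ≤ c ↔ 4 * B₁ * (ε₀ + C₁ * ε₁) ≤ c)) ∧
    (B₁ * (ε₀ + C₁ * ε₁) ≤ ε₂ → ε₂ ≤ ε₃ / 4 → 4 * B₁ * (ε₀ + C₁ * ε₁) ≤ ε₃) := by
  refine ⟨fun h => by rw [h], fun h₂ h₃ => by linarith⟩

/-! ## §5 The bundle of block 13 (pp. 289–294) keyed to the consumer -/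

/-- **BLOCK 13 OF [Balaban1985Variational] IN HYPOTHESIS FORM** — the printed statements of pp. 289–294 conjoined BY NAME over ONE
family `fam : I → SectDData` of Landau-gauge data (fixed d, L; constants chosen before the member): **Proposition 3** p. 289 with
(55), (73) (`B11.Prop3Printed`, through which rows (70)–(73) enter Sect. D), the **reduction to the chart** p. 290
(`ChartReductionPrinted`), the **analyticity of V** p. 290 (`V80AnalyticPrinted`), **Proposition 4** (97)–(98) pp. 292–293
(`B11.Prop4Printed`), the **bound (103) on H₁B** and the **range of the translation** p. 293 (`Ineq103H1BPrinted`,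
`TranslationRangePrinted`), **Proposition 5** (111)–(112) p. 294 (`B11.Prop5Printed`).  Shared constants: C₁, B₃ of (14); B₁ of [6]
Thm 2 ((19), (103), (113)); B₀ of [5] Thm 3.12 ((46), (71), (103)); C₂, C₃, c₄ of [4] Props 4–5; c1h = c₁(½), δ₀ of [3].  A node
prover takes `(h : Hyp C₁ B₃ B₁ B₀ C₂ C₃ c1h c₄ δ₀ fam)`; the PROVED rows of these pages (module docstring, § IN TREE) need no slot.
[cite: Balaban1985Variational, Prop. 3 p.289 + p.290 L3–7, L22 + Prop. 4 pp.292–293 + (103)–(104) p.293 + Prop. 5 p.294 (bundle by name)] -/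
def Hyp {I : Type} (C₁ B₃ B₁ B₀ C₂ C₃ c1h c₄ δ₀ : ℝ) (fam : I → SectDData) : Prop :=
  B11.Prop3Printed C₁ B₃ C₂ C₃ B₀ c1h c₄ δ₀ (fun i => (fam i).toLGData) ∧
    ChartReductionPrinted C₁ B₃ fam ∧
    V80AnalyticPrinted C₁ B₃ fam ∧
    B11.Prop4Printed C₁ B₃ (fun i => (fam i).toLGData) ∧
    Ineq103H1BPrinted B₀ C₁ B₃ fam ∧
    TranslationRangePrinted B₀ B₁ C₁ B₃ fam ∧
    B11.Prop5Printed B₁ B₃ C₁ (fun i => (fam i).toLGData)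

namespace Hyp

variable {C₁ B₃ B₁ B₀ C₂ C₃ c1h c₄ δ₀ : ℝ} {fam : I → SectDData}

/-- Accessor: Proposition 3 (p. 289) by name. [cite: Balaban1985Variational, Prop. 3 p.289] -/
theorem prop3 (h : Hyp C₁ B₃ B₁ B₀ C₂ C₃ c1h c₄ δ₀ fam) :
    B11.Prop3Printed C₁ B₃ C₂ C₃ B₀ c1h c₄ δ₀ (fun i => (fam i).toLGData) := h.1

/-- Accessor: the reduction to the chart (p. 290 L3–7). [cite: Balaban1985Variational, p.290 L3–7] -/
theorem chartReduction (h : Hyp C₁ B₃ B₁ B₀ C₂ C₃ c1h c₄ δ₀ fam) : ChartReductionPrinted C₁ B₃ fam := h.2.1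

/-- Accessor: analyticity of V (p. 290 L22). [cite: Balaban1985Variational, p.290 L22] -/
theorem vAnalytic (h : Hyp C₁ B₃ B₁ B₀ C₂ C₃ c1h c₄ δ₀ fam) : V80AnalyticPrinted C₁ B₃ fam := h.2.2.1

/-- Accessor: Proposition 4 (pp. 292–293) by name. [cite: Balaban1985Variational, Prop. 4 (97)–(98) pp.292–293] -/
theorem prop4 (h : Hyp C₁ B₃ B₁ B₀ C₂ C₃ c1h c₄ δ₀ fam) :
    B11.Prop4Printed C₁ B₃ (fun i => (fam i).toLGData) := h.2.2.2.1

/-- Accessor: the bound (103) on H₁B. [cite: Balaban1985Variational, (103) p.293] -/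
theorem ineq103 (h : Hyp C₁ B₃ B₁ B₀ C₂ C₃ c1h c₄ δ₀ fam) : Ineq103H1BPrinted B₀ C₁ B₃ fam := h.2.2.2.2.1

/-- Accessor: the range of the translation (p. 293 L26–29). [cite: Balaban1985Variational, p.293 L26–29] -/
theorem translationRange (h : Hyp C₁ B₃ B₁ B₀ C₂ C₃ c1h c₄ δ₀ fam) : TranslationRangePrinted B₀ B₁ C₁ B₃ fam :=
  h.2.2.2.2.2.1

/-- Accessor: Proposition 5 (p. 294) by name. [cite: Balaban1985Variational, Prop. 5 (111)–(112) p.294] -/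
theorem prop5 (h : Hyp C₁ B₃ B₁ B₀ C₂ C₃ c1h c₄ δ₀ fam) :
    B11.Prop5Printed B₁ B₃ C₁ (fun i => (fam i).toLGData) := h.2.2.2.2.2.2

/-- Derived: uniqueness on the chart ⇒ uniqueness in (19)–(21) (`unique19_21_of_uniqueChart` fed from the bundle).
[cite: Balaban1985Variational, p.290 L3–7 (bookkeeping)] -/
theorem unique19_21 (h : Hyp C₁ B₃ B₁ B₀ C₂ C₃ c1h c₄ δ₀ fam) :
    ∃ c : ℝ, 0 < c ∧ ∀ i : I, ∀ ε₁ ε₂ ε₃ : ℝ, 0 < ε₁ → 0 < ε₃ → ε₂ ≤ ε₃ / 4 → ε₃ ≤ c →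
      ∀ V : (fam i).Bdry, ∀ U₀ : (fam i).Cfg, (fam i).Sat14 (C₁ * B₃ * ε₁) (C₁ * ε₁) V U₀ →
        (∀ A' A'' : (fam i).Fld, (fam i).InChart ε₃ V U₀ A' → (fam i).CritF V U₀ A' →
          (fam i).InChart ε₃ V U₀ A'' → (fam i).CritF V U₀ A'' → A' = A'') →
        ∀ U₁ U₁' : (fam i).Pert, (fam i).In19_21 ε₂ V U₀ U₁ → (fam i).CritL V U₀ U₁ →
          (fam i).In19_21 ε₂ V U₀ U₁' → (fam i).CritL V U₀ U₁' → U₁ = U₁' :=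
  unique19_21_of_uniqueChart h.chartReduction

/-- Derived: **the translation range with (103) discharged from the bundle** — for ε₁ below the (103)-threshold, the chain
2dLB₀C₁ε₁ < B₁C₁ε₁ < ε₃ and U₀ with (14): (a) every A′ with (77) [ε₃] is a translate of an A₁ with (104); (b) translates of (104)-fields
satisfy (77) with 3ε₃. [cite: Balaban1985Variational, (103)–(104) p.293 and L26–29 (bookkeeping)] -/
theorem translation_range (h : Hyp C₁ B₃ B₁ B₀ C₂ C₃ c1h c₄ δ₀ fam) :
    ∃ c : ℝ, 0 < c ∧ ∀ i : I, ∀ ε₁ ε₃ : ℝ, 0 < ε₁ → ε₁ ≤ c →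
      2 * (fam i).dim * (fam i).L * B₀ * C₁ * ε₁ < B₁ * C₁ * ε₁ → B₁ * C₁ * ε₁ < ε₃ →
      ∀ V : (fam i).Bdry, ∀ U₀ : (fam i).Cfg, (fam i).Sat14 (C₁ * B₃ * ε₁) (C₁ * ε₁) V U₀ →
        (∀ A' : (fam i).Fld, (fam i).nMax U₀ A' < ε₃ →
          ∃ A₁ : (fam i).Fld, (fam i).nMax U₀ A₁ < 2 * ε₃ ∧ (fam i).transl V U₀ A₁ = A') ∧
        (∀ A₁ : (fam i).Fld, (fam i).nMax U₀ A₁ < 2 * ε₃ → (fam i).nMax U₀ ((fam i).transl V U₀ A₁) < 3 * ε₃) := by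
  obtain ⟨c, hc, H103⟩ := h.ineq103
  refine ⟨c, hc, fun i ε₁ ε₃ h1 h1c hch₁ hch₂ V U₀ h14 => ?_⟩
  exact h.translationRange i ε₁ ε₃ h1 hch₁ hch₂ V U₀ h14 (H103 i ε₁ h1 h1c V U₀ h14)

/-- Derived: **Proposition 4 on the image of the translation** — the instance for (98) of p. 293 L29–31 *"All the representations and
the estimates obtained up to now hold in this situation also, if we impose correspondingly stronger restrictions on ε₃ and change the
constants"*: for ε₁ below both thresholds, the (103) chain, and 3ε₃ ≤ a₃, every translate A′ = A₁ + H₁B of a field A₁ with (104)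
satisfies (77) with 3ε₃ and hence Proposition 4's bound (98) «|((δ/δA′)V)(A′)|₍₋₃₎ ≦ C₄(max{|A′|₍₋₁₎, |∇A′|₍₋₂₎})²» (so < 9C₄ε₃² when
the size is nonnegative — the «changed constant»). [cite: Balaban1985Variational, Prop. 4 (98) p.293 with p.293 L26–31 (bookkeeping)] -/
theorem prop4_on_translation (h : Hyp C₁ B₃ B₁ B₀ C₂ C₃ c1h c₄ δ₀ fam) :
    ∃ a₃ C₄ c : ℝ, 0 < a₃ ∧ 0 < C₄ ∧ 0 < c ∧ ∀ i : I, ∀ ε₁ ε₃ : ℝ, 0 < ε₁ → ε₁ ≤ c →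
      2 * (fam i).dim * (fam i).L * B₀ * C₁ * ε₁ < B₁ * C₁ * ε₁ → B₁ * C₁ * ε₁ < ε₃ → 3 * ε₃ ≤ a₃ →
      ∀ V : (fam i).Bdry, ∀ U₀ : (fam i).Cfg, (fam i).Sat14 (C₁ * B₃ * ε₁) (C₁ * ε₁) V U₀ →
        ∀ A₁ : (fam i).Fld, (fam i).nMax U₀ A₁ < 2 * ε₃ →
          (fam i).nMax U₀ ((fam i).transl V U₀ A₁) < 3 * ε₃ ∧
          (fam i).dVn U₀ ((fam i).transl V U₀ A₁) ≤ C₄ * (fam i).nMax U₀ ((fam i).transl V U₀ A₁) ^ 2 ∧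
          (0 ≤ (fam i).nMax U₀ ((fam i).transl V U₀ A₁) →
            (fam i).dVn U₀ ((fam i).transl V U₀ A₁) < 9 * C₄ * ε₃ ^ 2) := by
  obtain ⟨a₃, C₄, c₄', ha₃, hC₄, hc₄', H4⟩ := h.prop4
  obtain ⟨c, hc, HT⟩ := h.translation_range
  refine ⟨a₃, C₄, min c₄' c, ha₃, hC₄, lt_min hc₄' hc, fun i ε₁ ε₃ h1 h1c hch₁ hch₂ h3a V U₀ h14 A₁ hA₁ => ?_⟩
  have h1c₄ : ε₁ ≤ c₄' := h1c.trans (min_le_left _ _)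
  have h1c' : ε₁ ≤ c := h1c.trans (min_le_right _ _)
  obtain ⟨-, himg⟩ := HT i ε₁ ε₃ h1 h1c' hch₁ hch₂ V U₀ h14
  have hsize : (fam i).nMax U₀ ((fam i).transl V U₀ A₁) < 3 * ε₃ := himg A₁ hA₁
  obtain ⟨-, H98⟩ := H4 i ε₁ h1 h1c₄ V U₀ h14
  have h98 : (fam i).dVn U₀ ((fam i).transl V U₀ A₁) ≤ C₄ * (fam i).nMax U₀ ((fam i).transl V U₀ A₁) ^ 2 :=
    H98 ((fam i).transl V U₀ A₁) (by linarith)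
  refine ⟨hsize, h98, fun h0 => lt_of_le_of_lt h98 ?_⟩
  have hsq : (fam i).nMax U₀ ((fam i).transl V U₀ A₁) ^ 2 < (3 * ε₃) ^ 2 := by
    have h3pos : 0 < 3 * ε₃ := lt_of_le_of_lt h0 hsize
    nlinarith
  nlinarith

/-- Derived: with Proposition 2 of block 11 on the same family (`B11.Prop2Printed`), the bundle's chart reduction turns «at most one
critical configuration of 𝔉 on the chart» into «at most one critical orbit in (18)» (`axialCritical_related_of_uniqueChart`).
[cite: Balaban1985Variational, p.290 L3–7 with Prop. 2 p.281 (bookkeeping)] -/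
theorem axialCritical_related (h : Hyp C₁ B₃ B₁ B₀ C₂ C₃ c1h c₄ δ₀ fam) {c₁ : ℝ}
    (h2 : B11.Prop2Printed B₁ B₃ C₁ c₁ (fun i => (fam i).toLGData)) :
    ∃ c : ℝ, 0 < c ∧ ∀ i : I, ∀ ε₀ ε₁ ε₂ ε₃ : ℝ, 0 < ε₀ → 0 < ε₁ → ε₀ + C₁ * ε₁ ≤ c₁ →
      B₁ * (ε₀ + C₁ * ε₁) ≤ ε₂ → 0 < ε₃ → ε₂ ≤ ε₃ / 4 → ε₃ ≤ c →
      ∀ V : (fam i).Bdry, ∀ U₀ : (fam i).Cfg, (fam i).Sat14 (C₁ * B₃ * ε₁) (C₁ * ε₁) V U₀ →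
        (∀ A' A'' : (fam i).Fld, (fam i).InChart ε₃ V U₀ A' → (fam i).CritF V U₀ A' →
          (fam i).InChart ε₃ V U₀ A'' → (fam i).CritF V U₀ A'' → A' = A'') →
        ∀ U' U'' : (fam i).Pert, (fam i).In18 ε₀ V U₀ U' → (fam i).Crit V U₀ U' →
          (fam i).In18 ε₀ V U₀ U'' → (fam i).Crit V U₀ U'' →
            ∃ U₁ : (fam i).Pert, ∃ u u' : (fam i).GT, (fam i).In19_21 ε₂ V U₀ U₁ ∧ (fam i).CritL V U₀ U₁ ∧
              (fam i).Restricted U₀ u ∧ (fam i).Restricted U₀ u' ∧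
              (fam i).toAxial U₀ U₁ u = U' ∧ (fam i).toAxial U₀ U₁ u' = U'' :=
  axialCritical_related_of_uniqueChart h.chartReduction h2

end Hyp

end Literature.MathematicalPhysics.QuantumFieldTheory.Balaban1983to89.B11Carve13SectDHyp
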